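import Literature.Geometry.Riemannian.PinchingEstimatesTwoLargestCore
import Literature.Geometry.Riemannian.HamiltonODEMinBarrier
import Mathlib.Topology.Instances.Matrix
import HarnessLib

/-!
# Hamilton 1997, Thm. 1.4 at the level of the curvature ODE — proved
(topic `Geometry/Riemannian`)

Part of the decomposition of `Literature.Geometry.Riemannian.hamilton_chenZhu_pinching`
(`PinchingEstimates.lean`). Hamilton 1997, §2.1, Thm. 1.4 (p. 8): "There exist a constant
`Φ < ∞` depending only on the initial metric such that [`a₂ + a₃ ≤ Φ(a₁ + a₂)`] and
[`c₂ + c₃ ≤ Φ(c₁ + c₂)`]", proof pp. 8–9 ("… if `Φ ≥ Λ + 1` the inequality is preserved").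
PROVED here, in the shape used by `HamiltonODE.pinchingFamily` and the reduction
`hamilton_chenZhu_pinching_of_ode₈` (its hypothesis on Thm. 1.4):

* `isInvariantRel_twoLargest_fst` / `_snd` — relative to `{A, C symmetric} ∩ {a₁ + a₂ ≥ m}
  ∩ {c₁ + c₂ ≥ m} ∩ {(b₂ + b₃)² ≤ Λ(a₁ + a₂)(c₁ + c₂)} ∩ {tr A = tr C}` (`m > 0`, `Λ > 0`),
  the sets `{a₂ + a₃ ≤ Φ(a₁ + a₂)}` and `{c₂ + c₃ ≤ Φ(c₁ + c₂)}` are forward invariant under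
  Hamilton's ODE for `Φ ≥ Λ + 1`;
* `hamilton1997_B14_ode` — both blocks together, exactly the Thm. 1.4 hypothesis of
  `hamilton_chenZhu_pinching_of_ode₈` (`PinchingEstimatesReduction.lean`).

Proof: the barrier form of Hamilton's Lemma 3.1/3.5 (`minOverSet_nonneg_of_deriv`,
`HamiltonODEMinBarrier.lean`) for `G = Φ X(w, w') - X(u, v)` over `pairSet × pairSet`, with the
pointwise inequality `twoLargest_deriv_ge` (`PinchingEstimatesTwoLargestCore.lean`) at the
extremal pairs and a uniform bound for its coefficient along the compact time interval.

## References

* R. S. Hamilton, Comm. Anal. Geom. 5 (1997), §2.1, Thm. 1.4 and its proof (pp. 8–9). [Hamilton1997]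
* R. S. Hamilton, J. Differential Geom. 24 (1986), §3 (Lemmas 3.1, 3.5). [Hamilton1986]
-/

noncomputable section

open Set Real Filter
open scoped Matrix BigOperators Topology

namespace Literature.Geometry.Riemannian

namespace HamiltonODE

/-! ### Calculus and continuity of quadratic forms along a matrix curve -/

/-- Derivative of `uᵀA(t)w` for fixed vectors. [folklore] -/
theorem hasDerivAt_quadForm {A : ℝ → Matrix (Fin 3) (Fin 3) ℝ} {A' : Matrix (Fin 3) (Fin 3) ℝ} {s : ℝ}
    (hA : ∀ k l, _root_.HasDerivAt (fun t ↦ A t k l) (A' k l) s) (u w : Fin 3 → ℝ) :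
    _root_.HasDerivAt (fun t ↦ u ⬝ᵥ (A t *ᵥ w)) (u ⬝ᵥ (A' *ᵥ w)) s := by
  simp only [dotProduct, Matrix.mulVec]
  refine HasDerivAt.fun_sum fun k _ ↦ ?_
  refine (HasDerivAt.fun_sum fun l _ ↦ ?_).const_mul (u k)
  exact (hA k l).mul_const (w l)

/-- `(M, u, w) ↦ uᵀMw` is continuous. [folklore] -/
theorem continuous_quadForm :
    Continuous fun z : Matrix (Fin 3) (Fin 3) ℝ × (Fin 3 → ℝ) × (Fin 3 → ℝ) ↦ z.2.1 ⬝ᵥ (z.1 *ᵥ z.2.2) :=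
  (continuous_fst.comp continuous_snd).dotProduct
    (continuous_fst.matrix_mulVec (continuous_snd.comp continuous_snd))

/-- `(M, q) ↦ G_Φ(M, q)` is continuous. [folklore] -/
theorem continuous_twoLargestG (Φ : ℝ) :
    Continuous fun z : Matrix (Fin 3) (Fin 3) ℝ ×
      (((Fin 3 → ℝ) × (Fin 3 → ℝ)) × ((Fin 3 → ℝ) × (Fin 3 → ℝ))) ↦ twoLargestG Φ z.1 z.2 := by
  unfold twoLargestG pairSumQ
  have h := continuous_quadForm
  refine ((continuous_const.mul ((h.comp (continuous_fst.prodMk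
      ((continuous_fst.comp (continuous_snd.comp continuous_snd)).prodMk
        (continuous_fst.comp (continuous_snd.comp continuous_snd))))).add
      (h.comp (continuous_fst.prodMk
      ((continuous_snd.comp (continuous_snd.comp continuous_snd)).prodMk
        (continuous_snd.comp (continuous_snd.comp continuous_snd))))))).sub
      ((h.comp (continuous_fst.prodMk
      ((continuous_fst.comp (continuous_fst.comp continuous_snd)).prodMk
        (continuous_fst.comp (continuous_fst.comp continuous_snd))))).add
      (h.comp (continuous_fst.prodMk
      ((continuous_snd.comp (continuous_fst.comp continuous_snd)).prodMk
        (continuous_snd.comp (continuous_fst.comp continuous_snd)))))))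

/-- A matrix curve with continuous entries is continuous. [folklore] -/
theorem continuousOn_matrix {A : ℝ → Matrix (Fin 3) (Fin 3) ℝ} {S : Set ℝ}
    (h : ∀ k l, ContinuousOn (fun t ↦ A t k l) S) : ContinuousOn A S :=
  continuousOn_pi.2 fun k ↦ continuousOn_pi.2 fun l ↦ h k l

/-- Hamilton's field is continuous. [folklore] -/
theorem continuous_field : Continuous field := by
  unfold field
  have h1 : Continuous fun p : Blocks ↦ p.1 := continuous_fst
  have h2 : Continuous fun p : Blocks ↦ p.2.1 := continuous_fst.comp continuous_snd
  have h3 : Continuous fun p : Blocks ↦ p.2.2 := continuous_snd.comp continuous_snd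
  have hs : ∀ {f : Blocks → Matrix (Fin 3) (Fin 3) ℝ}, Continuous f →
      Continuous fun p ↦ (f p).sharp := fun hf ↦ hf.matrix_adjugate.matrix_transpose
  refine ((h1.matrix_mul h1).add (h2.matrix_mul h2.matrix_transpose) |>.add
    ((hs h1).const_smul (2 : ℝ))).prodMk ((((h1.matrix_mul h2).add (h2.matrix_mul h3)).add
    ((hs h2).const_smul (2 : ℝ))).prodMk (((h3.matrix_mul h3).add (h2.matrix_transpose.matrix_mul h2)).add
    ((hs h3).const_smul (2 : ℝ))))

/-- A solution of Hamilton's ODE on `[t₀, t₁]` is continuous there. [folklore] -/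
theorem IsSolutionOn.continuousOn {γ : ℝ → Blocks} {t₀ t₁ : ℝ}
    (hγ : IsSolutionOn field γ (Icc t₀ t₁)) : ContinuousOn γ (Icc t₀ t₁) := by
  refine (continuousOn_matrix fun k l s hs ↦ ((hγ s hs).1 k l).continuousAt.continuousWithinAt).prodMk
    ((continuousOn_matrix fun k l s hs ↦
      ((hγ s hs).2.1 k l).continuousAt.continuousWithinAt).prodMk
    (continuousOn_matrix fun k l s hs ↦ ((hγ s hs).2.2 k l).continuousAt.continuousWithinAt))

/-- `|tr M| ≤ Σ |M_{kl}|`. [folklore] -/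
theorem abs_trace_le_sum (M : Matrix (Fin 3) (Fin 3) ℝ) : |M.trace| ≤ ∑ k, ∑ l, |M k l| := by
  rw [Matrix.trace]
  refine (Finset.abs_sum_le_sum_abs _ _).trans (Finset.sum_le_sum fun k _ ↦ ?_)
  simpa using Finset.single_le_sum (f := fun l ↦ |M k l|) (fun l _ ↦ abs_nonneg _)
    (Finset.mem_univ k)

/-- `|uᵀMu| ≤ Σ |M_{kl}|` for a unit vector. [folklore] -/
theorem abs_quad_le_sum (M : Matrix (Fin 3) (Fin 3) ℝ) {u : Fin 3 → ℝ} (hu : u ⬝ᵥ u = 1) :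
    |u ⬝ᵥ (M *ᵥ u)| ≤ ∑ k, ∑ l, |M k l| := by
  simp only [dotProduct, Matrix.mulVec, Finset.mul_sum]
  refine (Finset.abs_sum_le_sum_abs _ _).trans (Finset.sum_le_sum fun k _ ↦
    (Finset.abs_sum_le_sum_abs _ _).trans (Finset.sum_le_sum fun l _ ↦ ?_))
  rw [abs_mul, abs_mul]
  have hk := abs_apply_le_one_of_dot_self hu k
  have hl := abs_apply_le_one_of_dot_self hu l
  have := abs_nonneg (M k l)
  calc |u k| * (|M k l| * |u l|) ≤ 1 * (|M k l| * 1) := by gcongr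
    _ = |M k l| := by ring

/-! ### Thm. 1.4, ODE part -/

/-- The parameter space `pairSet × pairSet`. [folklore] -/
abbrev PP : Type := ((Fin 3 → ℝ) × (Fin 3 → ℝ)) × ((Fin 3 → ℝ) × (Fin 3 → ℝ))

/-- Derivative of `G_Φ` along a matrix curve. [folklore] -/
theorem hasDerivAt_twoLargestG (Φ : ℝ) {A : ℝ → Matrix (Fin 3) (Fin 3) ℝ}
    {A' : Matrix (Fin 3) (Fin 3) ℝ} {s : ℝ} (hA : ∀ k l, _root_.HasDerivAt (fun t ↦ A t k l) (A' k l) s)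
    (q : PP) : _root_.HasDerivAt (fun t ↦ twoLargestG Φ (A t) q) (twoLargestG Φ A' q) s :=
  (((hasDerivAt_quadForm hA _ _).add (hasDerivAt_quadForm hA _ _)).const_mul Φ).sub
    ((hasDerivAt_quadForm hA _ _).add (hasDerivAt_quadForm hA _ _))

attribute [local irreducible] twoLargestG in
/-- Joint continuity of `G_Φ` along a continuous matrix curve. [folklore] -/
theorem continuousOn_twoLargestG (Φ : ℝ) {A : ℝ → Matrix (Fin 3) (Fin 3) ℝ} {S : Set ℝ}
    (hA : ContinuousOn A S) (K : Set PP) :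
    ContinuousOn (fun z : ℝ × PP ↦ twoLargestG Φ (A z.1) z.2) (S ×ˢ K) := by
  have h1 : ContinuousOn (fun z : ℝ × PP ↦ A z.1) (S ×ˢ K) :=
    hA.comp continuousOn_fst fun z hz ↦ (Set.mem_prod.1 hz).1
  have h2 : ContinuousOn (fun z : ℝ × PP ↦ (A z.1, z.2)) (S ×ˢ K) := h1.prodMk continuousOn_snd
  exact (continuous_twoLargestG Φ).continuousOn.comp h2 (Set.mapsTo_univ _ _)

/-- The coefficient of Hamilton's inequality is bounded in terms of `Σ |M_{kl}|`. [folklore] -/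
theorem coeff_le {M : Matrix (Fin 3) (Fin 3) ℝ} {R Λ Φ : ℝ} (hR : ∑ k, ∑ l, |M k l| ≤ R)
    {w w' : Fin 3 → ℝ} (hw : w ⬝ᵥ w = 1) (hw' : w' ⬝ᵥ w' = 1) :
    3 * M.trace + (Λ - 1 - 3 * Φ) * pairSumQ M (w, w') ≤ 3 * R + |Λ - 1 - 3 * Φ| * (2 * R) := by
  have h1 := (abs_trace_le_sum M).trans hR
  have h2 : |pairSumQ M (w, w')| ≤ 2 * R := by
    refine (abs_add_le _ _).trans ?_
    linarith [(abs_quad_le_sum M hw).trans hR, (abs_quad_le_sum M hw').trans hR]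
  have h3 := abs_le.1 h1
  have h4 : |(Λ - 1 - 3 * Φ) * pairSumQ M (w, w')| ≤ |Λ - 1 - 3 * Φ| * (2 * R) := by
    rw [abs_mul]; exact mul_le_mul_of_nonneg_left h2 (abs_nonneg _)
  have h5 := (abs_le.1 h4).2
  linarith

/-- **The sign condition at a minimiser of `G_Φ`** (pointwise): with the data of the constraint
set at time `s`, `C · G ≤ G'` whenever `G ≤ 0`, for `C = 3R + |Λ - 1 - 3Φ| · 2R`.
[cite: Hamilton1997, §2.1, Thm. 1.4 (proof, pp. 8–9)] -/
theorem twoLargest_sign (Φ : ℝ) {M N : Matrix (Fin 3) (Fin 3) ℝ} {m Λ R : ℝ} (hm : 0 < m)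
    (hΛ : 0 ≤ Λ) (hΦ : Λ + 1 ≤ Φ) (hM : M.IsSymm) (h12 : M.TwoSmallestEigenvaluesSumGE m)
    (hR : ∑ k, ∑ l, |M k l| ≤ R)
    (hB : ∀ u v w w' : Fin 3 → ℝ, u ⬝ᵥ u = 1 → v ⬝ᵥ v = 1 → u ⬝ᵥ v = 0 →
      w ⬝ᵥ w = 1 → w' ⬝ᵥ w' = 1 → w ⬝ᵥ w' = 0 → 0 ≤ pairSumQ M (w, w') →
      (∀ r ∈ pairSet, pairSumQ M r ≤ pairSumQ M (u, v)) →
      (Nᵀ *ᵥ u) ⬝ᵥ (Nᵀ *ᵥ u) + (Nᵀ *ᵥ v) ⬝ᵥ (Nᵀ *ᵥ v) ≤ Λ * pairSumQ M (w, w') * pairSumQ M (u, v))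
    {q : PP} (hq : q ∈ (pairSet ×ˢ pairSet : Set PP))
    (hqmin : IsMinOn (twoLargestG Φ M) (pairSet ×ˢ pairSet) q) (hG0 : twoLargestG Φ M q ≤ 0) :
    (3 * R + |Λ - 1 - 3 * Φ| * (2 * R)) * twoLargestG Φ M q ≤
      twoLargestG Φ (M * M + N * Nᵀ + (2 : ℝ) • M.sharp) q := by
  obtain ⟨⟨u, v⟩, ⟨w, w'⟩⟩ := q
  obtain ⟨⟨hu, hv, huv⟩, ⟨hw, hw', hww'⟩⟩ := hq
  have hΦ0 : 0 < Φ := by linarith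
  have hmaxq := isMaxOn_fst_of_isMinOn_G (Φ := Φ) (M := M) (q := ((u, v), (w, w')))
    ⟨⟨hu, hv, huv⟩, ⟨hw, hw', hww'⟩⟩ hqmin
  have hminq := isMinOn_snd_of_isMinOn_G hΦ0 (M := M) (q := ((u, v), (w, w')))
    ⟨⟨hu, hv, huv⟩, ⟨hw, hw', hww'⟩⟩ hqmin
  simp only at hmaxq hminq
  have hx : m ≤ pairSumQ M (w, w') := h12 w w' hw hw' hww'
  have hcore := twoLargest_deriv_ge (N := N) hM hm hΦ hΦ0.le h12 hu hv huv hw hw' hww' hmaxq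
    hminq (hB u v w w' hu hv huv hw hw' hww' (by simp only [pairSumQ] at hx ⊢; linarith) hmaxq)
  have hc := coeff_le (Λ := Λ) (Φ := Φ) hR hw hw'
  simp only [twoLargestG, pairSumQ] at hG0 hc hcore ⊢
  exact (mul_le_mul_of_nonpos_right hc hG0).trans hcore

section

variable (Φ : ℝ)

/-- The abstract step: the barrier lemma for `G_Φ` along a matrix curve `M` with field-shaped
derivative. [cite: Hamilton1997, §2.1, Thm. 1.4 (proof, pp. 8–9)] -/
theorem twoLargest_preserved {M N M' : ℝ → Matrix (Fin 3) (Fin 3) ℝ} {t₀ t₁ m Λ : ℝ}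
    (h₁ : t₀ ≤ t₁) (hm : 0 < m) (hΛ : 0 < Λ) (hΦ : Λ + 1 ≤ Φ)
    (hMc : ContinuousOn M (Icc t₀ t₁)) (hM'c : ContinuousOn M' (Icc t₀ t₁))
    (hM'eq : ∀ s ∈ Icc t₀ t₁, M' s = M s * M s + N s * (N s)ᵀ + (2 : ℝ) • (M s).sharp)
    (hderiv : ∀ s ∈ Icc t₀ t₁, ∀ k l, _root_.HasDerivAt (fun t ↦ M t k l) (M' s k l) s)
    (hsymm : ∀ s ∈ Icc t₀ t₁, (M s).IsSymm)
    (h12 : ∀ s ∈ Icc t₀ t₁, (M s).TwoSmallestEigenvaluesSumGE m)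
    (hB : ∀ s ∈ Ico t₀ t₁, ∀ u v w w' : Fin 3 → ℝ, u ⬝ᵥ u = 1 → v ⬝ᵥ v = 1 → u ⬝ᵥ v = 0 →
      w ⬝ᵥ w = 1 → w' ⬝ᵥ w' = 1 → w ⬝ᵥ w' = 0 → 0 ≤ pairSumQ (M s) (w, w') →
      (∀ r ∈ pairSet, pairSumQ (M s) r ≤ pairSumQ (M s) (u, v)) →
      ((N s)ᵀ *ᵥ u) ⬝ᵥ ((N s)ᵀ *ᵥ u) + ((N s)ᵀ *ᵥ v) ⬝ᵥ ((N s)ᵀ *ᵥ v) ≤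
        Λ * pairSumQ (M s) (w, w') * pairSumQ (M s) (u, v))
    (h0 : (M t₀).TwoLargestEigenvaluesSumLE Φ) : (M t₁).TwoLargestEigenvaluesSumLE Φ := by
  have hK : IsCompact (pairSet ×ˢ pairSet : Set PP) := isCompact_pairSet.prod isCompact_pairSet
  have hKne : (pairSet ×ˢ pairSet : Set PP).Nonempty := pairSet_nonempty.prod pairSet_nonempty
  have hGc := continuousOn_twoLargestG Φ hMc (pairSet ×ˢ pairSet)
  have hG'c := continuousOn_twoLargestG Φ hM'c (pairSet ×ˢ pairSet)
  have hGd : ∀ q ∈ (pairSet ×ˢ pairSet : Set PP), ∀ s ∈ Icc t₀ t₁,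
      _root_.HasDerivAt (fun t ↦ twoLargestG Φ (M t) q) (twoLargestG Φ (M' s) q) s :=
    fun q _ s hs ↦ hasDerivAt_twoLargestG Φ (hderiv s hs) q
  -- a uniform bound `R` for `Σ |M_{kl}|` on `[t₀, t₁]`
  have hScont : ContinuousOn (fun t ↦ ∑ k, ∑ l, |M t k l|) (Icc t₀ t₁) :=
    continuousOn_finsetSum _ fun k _ ↦ continuousOn_finsetSum _ fun l _ ↦
      ((continuousOn_pi.1 (continuousOn_pi.1 hMc k) l)).abs
  obtain ⟨sR, -, hR⟩ := isCompact_Icc.exists_isMaxOn (nonempty_Icc.2 h₁) hScont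
  have hR' : ∀ s ∈ Icc t₀ t₁, ∑ k, ∑ l, |M s k l| ≤ ∑ k, ∑ l, |M sR k l| := fun s hs ↦ hR hs
  have hC0 : 0 ≤ 3 * (∑ k, ∑ l, |M sR k l|) + |Λ - 1 - 3 * Φ| * (2 * ∑ k, ∑ l, |M sR k l|) := by
    positivity
  have key := minOverSet_nonneg_of_deriv (G := fun t q ↦ twoLargestG Φ (M t) q)
    (G' := fun t q ↦ twoLargestG Φ (M' t) q) hK hKne hGc hGd hG'c h₁ one_pos hC0 (η := 1)
    (fun s hs q hq hqmin _ hG0 ↦ ?_) ?_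
  · rw [twoLargestEigenvaluesSumLE_iff]
    exact (le_minOverSet_iff hK hKne (continuousOn_slice (G := fun t q ↦ twoLargestG Φ (M t) q)
      hGc (right_mem_Icc.2 h₁)) 0).1 key
  · have hsI : s ∈ Icc t₀ t₁ := Ico_subset_Icc_self hs
    have h := twoLargest_sign Φ (N := N s) hm hΛ.le hΦ (hsymm s hsI) (h12 s hsI) (hR' s hsI)
      (hB s hs) hq hqmin hG0
    simpa only [hM'eq s hsI] using h
  · refine (le_minOverSet_iff hK hKne (continuousOn_slice (G := fun t q ↦ twoLargestG Φ (M t) q)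
      hGc (left_mem_Icc.2 h₁)) 0).2 ?_
    exact (twoLargestEigenvaluesSumLE_iff Φ (M t₀)).1 h0

end

/-- **Hamilton 1997, Thm. 1.4, ODE part, block `A` (proved).** [cite: Hamilton1997, §2.1, Thm. 1.4 (pp. 8–9)] -/
theorem isInvariantRel_twoLargest_fst {m Λ Φ : ℝ} (hm : 0 < m) (hΛ : 0 < Λ) (hΦ : Λ + 1 ≤ Φ) :
    IsInvariantRel field
      (fun _ ↦ {p : Blocks | (p.1.IsSymm ∧ p.2.2.IsSymm) ∧ p.1.TwoSmallestEigenvaluesSumGE m ∧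
        p.2.2.TwoSmallestEigenvaluesSumGE m ∧ SingularValuesSumSqLE p Λ ∧
        p.1.trace = p.2.2.trace})
      (fun _ ↦ {p | p.1.TwoLargestEigenvaluesSumLE Φ}) := by
  intro γ t₀ t₁ _ h₁ hγ hK hin
  have hγc := IsSolutionOn.continuousOn hγ
  refine twoLargest_preserved Φ (M := fun s ↦ (γ s).1) (N := fun s ↦ (γ s).2.1)
    (M' := fun s ↦ (field (γ s)).1) h₁ hm hΛ hΦ (continuousOn_fst.comp hγc (mapsTo_univ _ _))
    (continuousOn_fst.comp (continuous_field.comp_continuousOn hγc) (mapsTo_univ _ _))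
    (fun s _ ↦ rfl) (fun s hs k l ↦ (hγ s hs).1 k l) (fun s hs ↦ (hK s hs).1.1)
    (fun s hs ↦ (hK s hs).2.1) (fun s hs u v w w' hu hv huv hw hw' hww' hx hmax ↦ ?_) hin
  obtain ⟨-, -, -, h13, htr⟩ := hK s (Ico_subset_Icc_self hs)
  exact bTerm_le_A hΛ.le h13 htr hu hv huv hw hw' hww' hx hmax

/-- **Hamilton 1997, Thm. 1.4, ODE part, block `C` (proved)** ("`C` is the same").
[cite: Hamilton1997, §2.1, Thm. 1.4 (pp. 8–9)] -/
theorem isInvariantRel_twoLargest_snd {m Λ Φ : ℝ} (hm : 0 < m) (hΛ : 0 < Λ) (hΦ : Λ + 1 ≤ Φ) :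
    IsInvariantRel field
      (fun _ ↦ {p : Blocks | (p.1.IsSymm ∧ p.2.2.IsSymm) ∧ p.1.TwoSmallestEigenvaluesSumGE m ∧
        p.2.2.TwoSmallestEigenvaluesSumGE m ∧ SingularValuesSumSqLE p Λ ∧
        p.1.trace = p.2.2.trace})
      (fun _ ↦ {p | p.2.2.TwoLargestEigenvaluesSumLE Φ}) := by
  intro γ t₀ t₁ _ h₁ hγ hK hin
  have hγc := IsSolutionOn.continuousOn hγ
  refine twoLargest_preserved Φ (M := fun s ↦ (γ s).2.2) (N := fun s ↦ (γ s).2.1ᵀ)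
    (M' := fun s ↦ (field (γ s)).2.2) h₁ hm hΛ hΦ
    ((continuousOn_snd.comp continuousOn_snd (mapsTo_univ _ _)).comp hγc (mapsTo_univ _ _))
    ((continuousOn_snd.comp continuousOn_snd (mapsTo_univ _ _)).comp
      (continuous_field.comp_continuousOn hγc) (mapsTo_univ _ _))
    (fun s _ ↦ field_snd_snd (γ s)) (fun s hs k l ↦ (hγ s hs).2.2 k l) (fun s hs ↦ (hK s hs).1.2)
    (fun s hs ↦ (hK s hs).2.2.1) (fun s hs u v w w' hu hv huv hw hw' hww' hx hmax ↦ ?_) hin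
  obtain ⟨-, -, -, h13, htr⟩ := hK s (Ico_subset_Icc_self hs)
  exact bTerm_le_C hΛ.le h13 htr hu hv huv hw hw' hww' hx hmax

/-- **Hamilton 1997, Thm. 1.4, ODE part, both blocks (proved)** — exactly the Thm. 1.4 hypothesis
of `hamilton_chenZhu_pinching_of_ode₈` (`PinchingEstimatesReduction.lean`).
[cite: Hamilton1997, §2.1, Thm. 1.4 (pp. 8–9)] -/
theorem hamilton1997_B14_ode : ∀ m Λ Φ : ℝ, 0 < m → 0 < Λ → Λ + 1 ≤ Φ →
    IsInvariantRel field
      (fun _ ↦ {p : Blocks | (p.1.IsSymm ∧ p.2.2.IsSymm) ∧ p.1.TwoSmallestEigenvaluesSumGE m ∧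
        p.2.2.TwoSmallestEigenvaluesSumGE m ∧ SingularValuesSumSqLE p Λ ∧
        p.1.trace = p.2.2.trace})
      (fun _ ↦ {p | p.1.TwoLargestEigenvaluesSumLE Φ ∧ p.2.2.TwoLargestEigenvaluesSumLE Φ}) :=
  fun _ _ _ hm hΛ hΦ ↦ (isInvariantRel_twoLargest_fst hm hΛ hΦ).inter
    (isInvariantRel_twoLargest_snd hm hΛ hΦ)

end HamiltonODE

end Literature.Geometry.Riemannian

end
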